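import Summits.Parity.GeneralizedHardyLittlewood.Theorems.LeeYangFibresAbsoluteUpgradeUniformDefs
import Summits.Parity.GeneralizedHardyLittlewood.Theorems.LeeYangFibresRelativeDimOneSingularMeanGlueAux
import Summits.Parity.GeneralizedHardyLittlewood.Theorems.LeeYangFibresRelativeDimOneSingularMeanGlueAux2
import Summits.Parity.GeneralizedHardyLittlewood.Theorems.LeeYangFibresRelativeDimOneDegenerateCount
import Mathlib.NumberTheory.Primorial
import HarnessLib

/-!
# Route `LeeYangFibres`, crux `AbsoluteUpgrade` (stmt-Parity-14116), line `Sketch` (uniform amplification):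
# medium collision moduli, part 1 — one square-free modulus `∏ Q`

Auxiliary file for the registered stub `stub_mediumCollisions` (D1 = `MediumCollisions`, vocabulary
`Theorems/LeeYangFibresAbsoluteUpgradeUniformDefs.lean`). For ONE finite set `Q` of primes `p > y`
(`y ≥ L`, so that no `p ∈ Q` divides a leading coefficient of `Ψ`) with `primorial(y) · ∏Q ≤ N`, we bound the
weighted average over the shift box of `F(H) ∏_{p ∈ Q} collisionCount(Ψ, H, p)`,
`F(H) = ∏_{p ≤ y} β_p(Ψ^{(H)})`, by

`∑_{H ∈ box} w(H) F(H) ∏_{p∈Q} cc(H,p) ≤ T^{2 #Q} · (F₀^{m+1} W_box / ∏Q + 4 m 7^m · primorial(y) · N^m · F₀^{m+1})`,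

`T = (m+1)t`, `F₀ = ∏_{p ≤ y} β_p(Ψ)`, `W_box = ∑_{box} w` (`sum_shiftBox_prod_collisionCount_le`, the registered
sub-goal of this file). Steps:

* `natCast_collisionCount_eq_sum` — `cc(H,p) = ∑_{idx : j ≠ j'} 1[p ∣ Δ_idx(H)]`, a sum of `≤ T²` indicators of
  LINEAR congruences on `H`; `prod_collisionCount_eq_sum_pi` — `∏_{p∈Q} cc(H,p)` expands over assignments
  `α ∈ Q → {idx}` (`Finset.prod_sum`);
* `sum_shiftBox_cond_le` — for one assignment `α`, the exact Chinese-remainder average `CondLocalAverage`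
  over cubes of side `P = primorial(y) ∏Q` feeds the landed cube lemma `shiftBox_sum_mul_sub_le`
  (`2`-Lipschitz weight): `∑_{box} w F ∏ 1[p ∣ Δ_{α p}] ≤ F₀^{m+1} W_box/∏Q + (2R+1)^m 4mP · P^m F₀^{m+1}/∏Q`
  with `(2R+1)P ≤ 7N`; the `1/∏Q` cancels against `P` in the error term;
* summing over the `≤ (T²)^{#Q}` assignments.

References: P. X. Gallagher, Mathematika 23 (1976), §2 [Gallagher1976]; B. Green, T. Tao, Ann. of Math. 171
(2010), Lemma 1.3 [GreenTao2010].
-/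

noncomputable section

open scoped BigOperators Classical Topology
open Finset Filter MeasureTheory Literature.NumberTheory.Sieve
open Summit.Parity.GeneralizedHardyLittlewood.Cruxes.RelativeDimOne.TranslateAmplification

namespace Summit.Parity.GeneralizedHardyLittlewood.Cruxes.AbsoluteUpgrade.UniformAmplification

open CellParityLaw.SectionAnnihilator.SingularRatio (singularProductPartial_nonneg)

variable {t m : ℕ}

/-! ### Collision counts as sums of indicators of linear congruences -/

/-- `cc(H, p) = ∑_{idx = ((j,j'),(i,i')), j ≠ j'} 1[p ∣ Δ_idx(H)]` (as a real number). [folklore] -/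
theorem natCast_collisionCount_eq_sum (Ψ : Fin t → AffLinForm 1) (H : Fin m → ℤ) (p : ℕ) :
    (collisionCount Ψ H p : ℝ) =
      ∑ x ∈ (Finset.univ : Finset (CollisionIndex m t)).filter (fun x => x.1.1 ≠ x.1.2),
        (if (p : ℤ) ∣ collisionForm Ψ H x.1.1 x.1.2 x.2.1 x.2.2 then (1 : ℝ) else 0) := by
  unfold collisionCount
  rw [Finset.natCast_card_filter, Finset.sum_filter]
  refine Finset.sum_congr rfl fun x _ => ?_
  rw [ite_and]

/-- `∏_{p ∈ Q} cc(H, p) = ∑_{α} ∏_{p ∈ Q} 1[p ∣ Δ_{α(p)}(H)]`, the sum over the assignments `α` of an index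
`((j,j'),(i,i'))`, `j ≠ j'`, to every `p ∈ Q` (`Finset.prod_sum`). [folklore] -/
theorem prod_collisionCount_eq_sum_pi (Ψ : Fin t → AffLinForm 1) (H : Fin m → ℤ) (Q : Finset ℕ) :
    ∏ p ∈ Q, (collisionCount Ψ H p : ℝ) =
      ∑ π ∈ Q.pi (fun _ => (Finset.univ : Finset (CollisionIndex m t)).filter (fun x => x.1.1 ≠ x.1.2)),
        ∏ x ∈ Q.attach, (if ((x.1 : ℕ) : ℤ) ∣ collisionForm Ψ H (π x.1 x.2).1.1 (π x.1 x.2).1.2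
            (π x.1 x.2).2.1 (π x.1 x.2).2.2 then (1 : ℝ) else 0) := by
  rw [← Finset.prod_sum Q (fun _ => (Finset.univ : Finset (CollisionIndex m t)).filter (fun x => x.1.1 ≠ x.1.2))
    (fun p x => (if (p : ℤ) ∣ collisionForm Ψ H x.1.1 x.1.2 x.2.1 x.2.2 then (1 : ℝ) else 0))]
  exact Finset.prod_congr rfl fun p _ => natCast_collisionCount_eq_sum Ψ H p

/-- The number of assignments is `≤ (T²)^{#Q} = T^{2 #Q}`, `T = (m+1)t`. [folklore] -/
theorem card_pi_collisionIndex_le (Q : Finset ℕ) :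
    (#(Q.pi (fun _ => (Finset.univ : Finset (CollisionIndex m t)).filter (fun x => x.1.1 ≠ x.1.2))) : ℝ) ≤
      (((m + 1) * t : ℕ) : ℝ) ^ (2 * #Q) := by
  rw [Finset.card_pi, Finset.prod_const, Nat.cast_pow, pow_mul]
  refine pow_le_pow_left₀ (Nat.cast_nonneg _) ?_ _
  have h : #((Finset.univ : Finset (CollisionIndex m t)).filter (fun x => x.1.1 ≠ x.1.2)) ≤
      ((m + 1) * t) ^ 2 := by
    refine (Finset.card_filter_le _ _).trans ?_
    rw [Finset.card_univ]
    simp only [Fintype.card_prod, Fintype.card_fin]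
    exact le_of_eq (by ring)
  exact_mod_cast h

/-! ### Primes above `y ≥ L` do not divide the leading coefficients -/

/-- For `‖Ψ‖_N ≤ L ≤ y < p` and `Ψ` non-degenerate, `p ∤ a_i` (`0 < |a_i| ≤ L < p`). [folklore] -/
theorem not_dvd_coeff_of_lt {Ψ : Fin t → AffLinForm 1} (hΨ : IsNondegenerateSystem Ψ) {N L y p : ℕ}
    (hL : affLinSize Ψ N ≤ L) (hLy : L ≤ y) (hp : y < p) (i : Fin t) : ¬ (p : ℤ) ∣ (Ψ i).coeff 0 := by
  intro h
  have h1 := natAbs_coeff_le_of_affLinSize_le hL i 0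
  have h2 : p ∣ ((Ψ i).coeff 0).natAbs := Int.natCast_dvd.mp h
  have h3 := Nat.le_of_dvd (Int.natAbs_pos.mpr (coeff_zero_ne_zero hΨ i)) h2
  omega

/-! ### One assignment: the cube lemma -/

/-- **One assignment.** For primes `Q` above `y`, not dividing the leading coefficients, with
`P = primorial(y) ∏Q ≤ N`, and an assignment `α` of a collision index with `j ≠ j'` to every `p ∈ Q`:
`∑_{H ∈ box} w(H) F(H) ∏_{p ∈ Q} 1[p ∣ Δ_{α p}(H)] ≤ F₀^{m+1} W_box / ∏Q + 4 m 7^m primorial(y) N^m F₀^{m+1}`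
(`CondLocalAverage` on the cubes of side `P`, then `shiftBox_sum_mul_sub_le`; `(2R+1) P ≤ 4N + 3P ≤ 7N`).
[cite: Gallagher1976, Section 2] -/
theorem sum_shiftBox_cond_le (hB : CondLocalAverage) {N y : ℕ} (Ψ : Fin t → AffLinForm 1)
    (w : (Fin m → ℤ) → ℝ)
    (hw : ∀ H H' : Fin m → ℤ, |w H - w H'| ≤ 2 * ∑ j, |((H j : ℤ) : ℝ) - (H' j : ℝ)|)
    (hw0 : ∀ H, H ∉ shiftBox m N → w H = 0) (Q : Finset ℕ) (hQ : ∀ p ∈ Q, p.Prime)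
    (hyQ : ∀ p ∈ Q, y < p) (hcop : ∀ p ∈ Q, ∀ i, ¬ (p : ℤ) ∣ (Ψ i).coeff 0)
    (hPN : primorial y * ∏ p ∈ Q, p ≤ N) (α : ℕ → CollisionIndex m t)
    (hα : ∀ p ∈ Q, (α p).1.1 ≠ (α p).1.2) :
    ∑ H ∈ shiftBox m N, w H * (singularProductPartial (translateFamily Ψ H) y *
        ∏ p ∈ Q, (if (p : ℤ) ∣ collisionForm Ψ H (α p).1.1 (α p).1.2 (α p).2.1 (α p).2.2
          then (1 : ℝ) else 0)) ≤
      singularProductPartial Ψ y ^ (m + 1) / (∏ p ∈ Q, (p : ℝ)) * ∑ H ∈ shiftBox m N, w H +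
        4 * m * 7 ^ m * primorial y * (N : ℝ) ^ m * singularProductPartial Ψ y ^ (m + 1) := by
  -- the side `P = primorial y · ∏Q` of the cubes and the number `(2R+1)^m` of cubes
  have hq0 : 0 < ∏ p ∈ Q, p := Finset.prod_pos fun p hp => (hQ p hp).pos
  have hP0 : 0 < primorial y * ∏ p ∈ Q, p := Nat.mul_pos (primorial_pos y) hq0
  have hR : 2 * N < (2 * N / (primorial y * ∏ p ∈ Q, p) + 1) * (primorial y * ∏ p ∈ Q, p) := by
    rw [Nat.add_mul, one_mul]
    exact Nat.lt_div_mul_add hP0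
  have hqr : (0 : ℝ) < ∏ p ∈ Q, (p : ℝ) := by
    rw [← Nat.cast_prod]
    exact_mod_cast hq0
  have hF₀ : 0 ≤ singularProductPartial Ψ y := singularProductPartial_nonneg _ _
  have hF0 : 0 ≤ singularProductPartial Ψ y ^ (m + 1) / ∏ p ∈ Q, (p : ℝ) :=
    div_nonneg (pow_nonneg hF₀ _) hqr.le
  have hG : ∀ H : Fin m → ℤ, 0 ≤ singularProductPartial (translateFamily Ψ H) y *
      ∏ p ∈ Q, (if (p : ℤ) ∣ collisionForm Ψ H (α p).1.1 (α p).1.2 (α p).2.1 (α p).2.2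
        then (1 : ℝ) else 0) := fun H =>
    mul_nonneg (singularProductPartial_nonneg _ _)
      (Finset.prod_nonneg fun p _ => by split_ifs <;> norm_num)
  -- the exact average over one cube (`CondLocalAverage` with `S = primes ≤ y`)
  have hdisj : Disjoint (Nat.primesLE y) Q := Finset.disjoint_left.mpr fun p hpS hpQ => by
    have h1 := Nat.le_of_mem_primesLE hpS
    have h2 := hyQ p hpQ
    omega
  have hSQ : ∏ p ∈ Nat.primesLE y ∪ Q, p = primorial y * ∏ p ∈ Q, p := by
    rw [Finset.prod_union hdisj, primorial_eq_prod_primesLE]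
  have hsum : ∀ a : Fin m → ℤ,
      ∑ H ∈ Fintype.piFinset (fun j : Fin m => Finset.Ico (a j) (a j + (primorial y * ∏ p ∈ Q, p : ℕ))),
        singularProductPartial (translateFamily Ψ H) y *
          ∏ p ∈ Q, (if (p : ℤ) ∣ collisionForm Ψ H (α p).1.1 (α p).1.2 (α p).2.1 (α p).2.2
            then (1 : ℝ) else 0) =
        ((primorial y * ∏ p ∈ Q, p : ℕ) : ℝ) ^ m *
          (singularProductPartial Ψ y ^ (m + 1) / ∏ p ∈ Q, (p : ℝ)) := by
    intro a
    have h := hB m t Ψ (Nat.primesLE y) Q (fun p hp => Nat.prime_of_mem_primesLE hp) hQ hdisj α hα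
      hcop a
    have hcast : ∏ p ∈ Nat.primesLE y ∪ Q, (p : ℤ) = ((primorial y * ∏ p ∈ Q, p : ℕ) : ℤ) := by
      rw [← hSQ, Nat.cast_prod]
    rw [hcast, hSQ, Finset.prod_pow, Nat.cast_prod, mul_div_assoc] at h
    exact h
  -- the cube lemma
  have hcube := shiftBox_sum_mul_sub_le hP0 hR w _ _ hG hF0 hw hw0 hsum
  have h1 := (abs_le.mp hcube).2
  -- `(2R+1) P ≤ 7 N`
  have hRP : ((2 * (2 * N / (primorial y * ∏ p ∈ Q, p) + 1) + 1 : ℕ) : ℝ) *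
      ((primorial y * ∏ p ∈ Q, p : ℕ) : ℝ) ≤ 7 * N := by
    have h : (2 * (2 * N / (primorial y * ∏ p ∈ Q, p) + 1) + 1) * (primorial y * ∏ p ∈ Q, p) ≤
        7 * N := by
      have := Nat.div_mul_le_self (2 * N) (primorial y * ∏ p ∈ Q, p)
      nlinarith
    exact_mod_cast h
  have hPF0 : ((primorial y * ∏ p ∈ Q, p : ℕ) : ℝ) *
      (singularProductPartial Ψ y ^ (m + 1) / ∏ p ∈ Q, (p : ℝ)) =
        primorial y * singularProductPartial Ψ y ^ (m + 1) := by
    rw [Nat.cast_mul, Nat.cast_prod, mul_div_assoc', mul_assoc, mul_div_assoc,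
      mul_div_cancel_left₀ _ hqr.ne']
  have hE : (2 * ((2 * N / (primorial y * ∏ p ∈ Q, p) + 1 : ℕ) : ℝ) + 1) ^ m *
      (4 * m * ((primorial y * ∏ p ∈ Q, p : ℕ) : ℝ) *
        (((primorial y * ∏ p ∈ Q, p : ℕ) : ℝ) ^ m *
          (singularProductPartial Ψ y ^ (m + 1) / ∏ p ∈ Q, (p : ℝ)))) ≤
      4 * m * 7 ^ m * primorial y * (N : ℝ) ^ m * singularProductPartial Ψ y ^ (m + 1) := by
    have h7 : ((2 * ((2 * N / (primorial y * ∏ p ∈ Q, p) + 1 : ℕ) : ℝ) + 1) *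
        ((primorial y * ∏ p ∈ Q, p : ℕ) : ℝ)) ^ m ≤ (7 * (N : ℝ)) ^ m := by
      refine pow_le_pow_left₀ (by positivity) ?_ m
      have : (2 * ((2 * N / (primorial y * ∏ p ∈ Q, p) + 1 : ℕ) : ℝ) + 1) =
          ((2 * (2 * N / (primorial y * ∏ p ∈ Q, p) + 1) + 1 : ℕ) : ℝ) := by push_cast; ring
      rw [this]
      exact hRP
    have hPF0' : 0 ≤ (primorial y : ℝ) * singularProductPartial Ψ y ^ (m + 1) := by positivity
    calc (2 * ((2 * N / (primorial y * ∏ p ∈ Q, p) + 1 : ℕ) : ℝ) + 1) ^ m *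
          (4 * m * ((primorial y * ∏ p ∈ Q, p : ℕ) : ℝ) *
            (((primorial y * ∏ p ∈ Q, p : ℕ) : ℝ) ^ m *
              (singularProductPartial Ψ y ^ (m + 1) / ∏ p ∈ Q, (p : ℝ))))
        = 4 * m * ((2 * ((2 * N / (primorial y * ∏ p ∈ Q, p) + 1 : ℕ) : ℝ) + 1) *
            ((primorial y * ∏ p ∈ Q, p : ℕ) : ℝ)) ^ m *
            (((primorial y * ∏ p ∈ Q, p : ℕ) : ℝ) *
              (singularProductPartial Ψ y ^ (m + 1) / ∏ p ∈ Q, (p : ℝ))) := by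
          rw [mul_pow]; ring
      _ = 4 * m * ((2 * ((2 * N / (primorial y * ∏ p ∈ Q, p) + 1 : ℕ) : ℝ) + 1) *
            ((primorial y * ∏ p ∈ Q, p : ℕ) : ℝ)) ^ m *
            (primorial y * singularProductPartial Ψ y ^ (m + 1)) := by rw [hPF0]
      _ ≤ 4 * m * (7 * (N : ℝ)) ^ m * (primorial y * singularProductPartial Ψ y ^ (m + 1)) := by
          gcongr
      _ = 4 * m * 7 ^ m * primorial y * (N : ℝ) ^ m * singularProductPartial Ψ y ^ (m + 1) := by
          rw [mul_pow]; ring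
  linarith

/-! ### All assignments -/

/-- Extension of an assignment on `Q` to all of `ℕ` by a default index. [folklore] -/
theorem prod_attach_pi_eq (Ψ : Fin t → AffLinForm 1) (H : Fin m → ℤ) (Q : Finset ℕ)
    (π : (a : ℕ) → a ∈ Q → CollisionIndex m t) (d : CollisionIndex m t) :
    ∏ x ∈ Q.attach, (if ((x.1 : ℕ) : ℤ) ∣ collisionForm Ψ H (π x.1 x.2).1.1 (π x.1 x.2).1.2
        (π x.1 x.2).2.1 (π x.1 x.2).2.2 then (1 : ℝ) else 0) =
      ∏ p ∈ Q, (if (p : ℤ) ∣ collisionForm Ψ H (if h : p ∈ Q then π p h else d).1.1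
        (if h : p ∈ Q then π p h else d).1.2 (if h : p ∈ Q then π p h else d).2.1
        (if h : p ∈ Q then π p h else d).2.2 then (1 : ℝ) else 0) := by
  rw [← Finset.prod_attach Q]
  refine Finset.prod_congr rfl fun x _ => ?_
  simp only [dif_pos x.2]

/-- **`sum_shiftBox_prod_collisionCount_le`** (registered sub-goal of this auxiliary file): for ONE finite set `Q`
of primes above `y ≥ L` with `primorial(y) · ∏Q ≤ N`, a non-negative `2`-Lipschitz weight `w` vanishing off the
shift box, and `CondLocalAverage`:
`∑_{H ∈ box} w(H) (∏_{p ≤ y} β_p(Ψ^{(H)})) ∏_{p∈Q} cc(H,p) ≤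
  T^{2 #Q} (F₀^{m+1} W_box / ∏Q + 4 m 7^m primorial(y) N^m F₀^{m+1})`, `T = (m+1)t`, `F₀ = ∏_{p ≤ y} β_p(Ψ)`.
[cite: Gallagher1976, Section 2] -/
theorem sum_shiftBox_prod_collisionCount_le : ∀ (m t N L y : ℕ) (Ψ : Fin t → AffLinForm 1) (w : (Fin m → ℤ) → ℝ) (Q : Finset ℕ), CondLocalAverage → 1 ≤ t → IsNondegenerateSystem Ψ → affLinSize Ψ N ≤ L → L ≤ y → (∀ H, 0 ≤ w H) → (∀ H H' : Fin m → ℤ, |w H - w H'| ≤ 2 * ∑ j, |((H j : ℤ) : ℝ) - (H' j : ℝ)|) → (∀ H, H ∉ shiftBox m N → w H = 0) → (∀ p ∈ Q, p.Prime) → (∀ p ∈ Q, y < p) → primorial y * ∏ p ∈ Q, p ≤ N → ∑ H ∈ shiftBox m N, w H * singularProductPartial (translateFamily Ψ H) y * ∏ p ∈ Q, (collisionCount Ψ H p : ℝ) ≤ (((m + 1) * t : ℕ) : ℝ) ^ (2 * #Q) * (singularProductPartial Ψ y ^ (m + 1) / (∏ p ∈ Q, (p : ℝ)) * ∑ H ∈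 shiftBox m N, w H + 4 * m * 7 ^ m * primorial y * (N : ℝ) ^ m * singularProductPartial Ψ y ^ (m + 1)) := by
  intro m t N L y Ψ w Q hB ht hΨ hL hLy hwnn hw hw0 hQ hyQ hPN
  have hcop : ∀ p ∈ Q, ∀ i, ¬ (p : ℤ) ∣ (Ψ i).coeff 0 := fun p hp i =>
    not_dvd_coeff_of_lt hΨ hL hLy (hyQ p hp) i
  -- a default collision index (`t ≥ 1`)
  set d : CollisionIndex m t := ((0, 0), (⟨0, ht⟩, ⟨0, ht⟩)) with hd
  set I := (Finset.univ : Finset (CollisionIndex m t)).filter (fun x => x.1.1 ≠ x.1.2) with hI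
  -- the bound for one assignment
  set Bd : ℝ := singularProductPartial Ψ y ^ (m + 1) / (∏ p ∈ Q, (p : ℝ)) * ∑ H ∈ shiftBox m N, w H +
    4 * m * 7 ^ m * primorial y * (N : ℝ) ^ m * singularProductPartial Ψ y ^ (m + 1) with hBd
  have hF₀ : 0 ≤ singularProductPartial Ψ y := singularProductPartial_nonneg _ _
  have hqr : (0 : ℝ) < ∏ p ∈ Q, (p : ℝ) := Finset.prod_pos fun p hp => by exact_mod_cast (hQ p hp).pos
  have hBd0 : 0 ≤ Bd := by
    have : 0 ≤ ∑ H ∈ shiftBox m N, w H := Finset.sum_nonneg fun H _ => hwnn H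
    positivity
  -- expand the collision counts over assignments and swap the sums
  have hexp : ∀ H : Fin m → ℤ,
      w H * singularProductPartial (translateFamily Ψ H) y * ∏ p ∈ Q, (collisionCount Ψ H p : ℝ) =
        ∑ π ∈ Q.pi (fun _ => I), w H * (singularProductPartial (translateFamily Ψ H) y *
          ∏ p ∈ Q, (if (p : ℤ) ∣ collisionForm Ψ H (if h : p ∈ Q then π p h else d).1.1
            (if h : p ∈ Q then π p h else d).1.2 (if h : p ∈ Q then π p h else d).2.1
            (if h : p ∈ Q then π p h else d).2.2 then (1 : ℝ) else 0)) := by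
    intro H
    rw [prod_collisionCount_eq_sum_pi, Finset.mul_sum]
    refine Finset.sum_congr rfl fun π _ => ?_
    rw [prod_attach_pi_eq Ψ H Q π d, mul_assoc]
  rw [Finset.sum_congr rfl fun H _ => hexp H, Finset.sum_comm]
  calc ∑ π ∈ Q.pi (fun _ => I), ∑ H ∈ shiftBox m N, w H *
          (singularProductPartial (translateFamily Ψ H) y *
            ∏ p ∈ Q, (if (p : ℤ) ∣ collisionForm Ψ H (if h : p ∈ Q then π p h else d).1.1
              (if h : p ∈ Q then π p h else d).1.2 (if h : p ∈ Q then π p h else d).2.1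
              (if h : p ∈ Q then π p h else d).2.2 then (1 : ℝ) else 0))
      ≤ ∑ _π ∈ Q.pi (fun _ => I), Bd := by
        refine Finset.sum_le_sum fun π hπ => ?_
        refine sum_shiftBox_cond_le hB Ψ w hw hw0 Q hQ hyQ hcop hPN _ fun p hp => ?_
        have hmem : π p hp ∈ I := Finset.mem_pi.mp hπ p hp
        rw [hI, Finset.mem_filter] at hmem
        simp only [dif_pos hp]
        exact hmem.2
    _ = #(Q.pi (fun _ => I)) * Bd := by rw [Finset.sum_const, nsmul_eq_mul]
    _ ≤ (((m + 1) * t : ℕ) : ℝ) ^ (2 * #Q) * Bd :=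
        mul_le_mul_of_nonneg_right (card_pi_collisionIndex_le Q) hBd0

end Summit.Parity.GeneralizedHardyLittlewood.Cruxes.AbsoluteUpgrade.UniformAmplification

end
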